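import Literature.AnabelianGeometry.SemiGraphs.ProSigmaCompletionLifting
import Literature.IUT.HodgeTheaters.ProfiniteCompletionLifting
import Literature.GroupTheory.CombinatorialGroupTheory.FreeGroupCommutingPowers
import Mathlib.GroupTheory.NoncommCoprod
import Mathlib.Topology.Instances.ZMod
import HarnessLib

/-!
# Pro-`Σ` completions of nonabelian free groups are slim ([AbsAnab] Lemma 1.3.1, affine case)

[AbsAnab] (Mochizuki, *The absolute anabelian geometry of hyperbolic curves*, 2004), Definition 0.1 (i),
p. 3: a profinite group `G` is *slim* if the centralizer `Z_G(H)` of any open subgroup `H ⊆ G` is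
trivial; Remark 0.1.3, p. 4 (F. Oort): `G` is slim iff every open subgroup of `G` has trivial center;
Lemma 1.3.1, p. 15: "The profinite groups `Δ_X`, `Π_X` [of a hyperbolic curve] are slim"
[cite: MochizukiAbsAnab2004, Lemma 1.3.1 p.15].  [SemiAnbd] Example 2.10, p. 31 uses the pro-`Σ`
version: the vertex groups of a semi-graph of anabelioids of a pointed stable curve — pro-`Σ`
completions of punctured surface groups — are slim ("verticially slim", "cf. the proof of [Mzk3],
Lemma 1.3.1") [cite: MochizukiSemiAnbd2006, Ex. 2.10 p.31].

This file PROVES the group-theoretic core in the AFFINE case (free `π₁`): for a nonabelian free group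
`Γ` (`IsFreeGroup`, e.g. `Γ_{g,r}` with `r ≥ 1`), every pro-`Σ` completion `ι : Γ → P` in the sense of
abc-iut-L3-t1's `IsProSigmaCompletion Sigma ι` (`P` profinite) is slim (`IsProSigmaCompletion.isSlimGroup`)
and in particular center-free (`IsProSigmaCompletion.center_eq_bot`).

Route (ours — the printed proof, p. 15, goes through generalized Jacobians / [Naka1] Cor. 1.3.4; we
use the elementary wreath-product obstruction of abc-iut-L5-t17's proof of [IUTchI] Lemma 2.7 (v),
ported from `Ĝ` to pro-`Σ` completions):
* by Remark 0.1.3 it suffices that every open subgroup `W` of `P` be center-free; `ι⁻¹(W) → W` is again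
  a pro-`Σ` completion of a nonabelian free group (`restrict_isOpen`), so it suffices to show that `P`
  itself is center-free;
* if `z ∈ Z(P)`, `z ≠ 1`, then for one of two distinct free generators `a` of `Γ` and some open normal
  `N ⊴ P`, the class of `z` in `P/N` is not a power of the class of `τ = ι(a)` (otherwise the two
  "coordinate characters" `Γ → ℤ/[P:N₀]` kill `z` at a level `N₀ ∌ z`) — `exists_openNormal_not_mem_zpowers`;
* twisting `z` by a power of `τ` into the kernel of the coordinate character `χ : P → ℤ/m`, `m = |P/N|`,
  a power `k₁` of the twist has prime order `p ∈ Σ` in `P/N` and commutes with `τ`; on the open subgroup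
  `U = Ψ⁻¹⟨Ψτ, Ψk₁⟩`, `Ψ = (P → P/N, χ)`, reduction mod `p` gives a continuous `U → (ℤ/p)²` with
  `τ ↦ e₁`, `k₁ ↦ e₂`; by the lifting lemma (`exists_lift_of_isOpen`, Nielsen–Schreier) it lifts to
  `C_p ≀ C_p`, where lifts of `e₁`, `e₂` never commute (abc-iut-L5-t17's `wreath_not_commute`) —
  contradiction (`false_of_not_mem_zpowers`).

Honest scope: the PROPER case (`r = 0`, closed surface groups of genus `≥ 2`) is NOT treated here — the
lifting lemma fails for surface groups.  Theorems only; no side is taken on [IUTchIII] Cor. 3.12.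
-/

namespace Literature.AnabelianGeometry.SemiGraphs.SemiGraphOfAnabelioids.IsProSigmaCompletion

open Literature.AnabelianGeometry.Anabelioids Literature.AlgebraicGeometry.Frobenioids Topology
open Multiplicative
open Literature.IUT.HodgeTheaters.ProfiniteCompletion (exists_wreath_prod_hom wreath_pair_surjective
  wreath_not_commute)
open Literature.GroupTheory.CombinatorialGroupTheory (exists_generators_ne
  exists_not_commute_of_finiteIndex_of_isFreeGroup)

variable {Sigma : Set ℕ} {Γ : Type*} [Group Γ] {P : Type*} [Group P] [TopologicalSpace P]
  {ι : Γ →* P}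

/-- `|C_p ≀ C_p| = p^p · p` is a `Σ`-integer when `p ∈ Σ`. [cite: MochizukiSemiAnbd2006, Def. 2.9(i) p.31] -/
theorem isSigmaInteger_card_wreath (p : ℕ) [hp : Fact p.Prime] (hpS : p ∈ Sigma) :
    IsSigmaInteger Sigma (Nat.card (Multiplicative (ZMod p) ≀ᵣ Multiplicative (ZMod p))) := by
  haveI : NeZero p := ⟨hp.out.ne_zero⟩
  rw [RegularWreathProduct.card]
  have hc : Nat.card (Multiplicative (ZMod p)) = p := Nat.card_zmod p
  rw [hc]
  refine ⟨Nat.mul_pos (Nat.pow_pos hp.out.pos) hp.out.pos, fun q hq hdvd => ?_⟩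
  have hqp : q ∣ p := by
    rcases (Nat.Prime.dvd_mul hq).mp hdvd with h | h
    · exact hq.dvd_of_dvd_pow h
    · exact h
  rwa [(Nat.prime_dvd_prime_iff_eq hq hp.out).mp hqp]

section Profinite

variable [IsTopologicalGroup P] [CompactSpace P] [TotallyDisconnectedSpace P]

/-! ### Step 1: separating `z ≠ 1` from the powers of a free generator at a finite level -/

/-- **Separation.**  Let `Γ` be free with two distinct free generators `a₁ ≠ a₂`, `ι : Γ → P` a pro-`Σ`
completion (`P` profinite), and `z ∈ P`, `z ≠ 1`.  Then for `a = a₁` or `a = a₂` there is an open normal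
subgroup `N ⊴ P` such that the class of `z` in `P/N` is NOT a power of the class of `ι(a)`.  (Otherwise,
with `N₀ ∌ z` open normal and the coordinate characters `χ₁, χ₂ : P → ℤ/[P:N₀]` — continuous extensions
of `aᵢ ↦ 1`, `a_j ↦ 0` — at the level `N = N₀ ∩ Ker χ₁ ∩ Ker χ₂` the relation `z ≡ ι(a₂)^{s}` forces
`[P:N₀] ∣ s`, whence `z ∈ N₀`.) [cite: MochizukiAbsAnab2004, Lemma 1.3.1 p.15] -/
theorem exists_openNormal_not_mem_zpowers [IsFreeGroup Γ] [T2Space P]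
    (hι : IsProSigmaCompletion Sigma ι) {a₁ a₂ : IsFreeGroup.Generators Γ} (h12 : a₁ ≠ a₂)
    {z : P} (hz1 : z ≠ 1) :
    ∃ (a : IsFreeGroup.Generators Γ) (N : OpenNormalSubgroup P),
      (QuotientGroup.mk z : P ⧸ (N : Subgroup P)) ∉
        Subgroup.zpowers (QuotientGroup.mk (ι (IsFreeGroup.of a))) := by
  classical
  -- an open normal `N₀` missing `z`
  obtain ⟨N₀, hN₀⟩ := ProfiniteGrp.exist_openNormalSubgroup_sub_open_nhds_of_one
    (isOpen_compl_singleton (x := z)) (show (1 : P) ∈ ({z}ᶜ : Set P) from fun h => hz1 h.symm)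
  have hzN₀ : z ∉ (N₀ : Subgroup P) := fun h => hN₀ h rfl
  haveI : (N₀ : Subgroup P).Normal := N₀.isNormal'
  obtain ⟨n, hndef⟩ : ∃ n, n = (N₀ : Subgroup P).index := ⟨_, rfl⟩
  have hn : IsSigmaInteger Sigma n := hndef ▸ hι.index_open _ N₀.isNormal' N₀.isOpen'
  haveI : NeZero n := ⟨hn.1.ne'⟩
  have hcard : IsSigmaInteger Sigma (Nat.card (Multiplicative (ZMod n))) := by
    rw [show Nat.card (Multiplicative (ZMod n)) = n from Nat.card_zmod n]; exact hn
  -- coordinate characters `aᵢ ↦ 1`, extended continuously to `P`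
  let χ₀ : IsFreeGroup.Generators Γ → (Γ →* Multiplicative (ZMod n)) := fun a =>
    IsFreeGroup.lift fun g => if g = a then ofAdd (1 : ZMod n) else 1
  have hχ₀ : ∀ a b, χ₀ a (IsFreeGroup.of b) = if b = a then ofAdd (1 : ZMod n) else 1 :=
    fun a b => by simp [χ₀]
  obtain ⟨χ₁, hχ₁c, hχ₁⟩ := exists_continuous_extend_top hι hcard (χ₀ a₁)
  obtain ⟨χ₂, hχ₂c, hχ₂⟩ := exists_continuous_extend_top hι hcard (χ₀ a₂)
  -- the level `N = N₀ ∩ Ker χ₁ ∩ Ker χ₂`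
  have hk₁ : IsOpen (χ₁.ker : Set P) := (isOpen_discrete ({1} : Set _)).preimage hχ₁c
  have hk₂ : IsOpen (χ₂.ker : Set P) := (isOpen_discrete ({1} : Set _)).preimage hχ₂c
  let K₁ : OpenNormalSubgroup P := { toSubgroup := χ₁.ker, isOpen' := hk₁ }
  let K₂ : OpenNormalSubgroup P := { toSubgroup := χ₂.ker, isOpen' := hk₂ }
  let N : OpenNormalSubgroup P := (N₀ ⊓ K₁) ⊓ K₂
  have hNle₀ : (N : Subgroup P) ≤ (N₀ : Subgroup P) := fun x hx => hx.1.1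
  have hNle₁ : (N : Subgroup P) ≤ χ₁.ker := fun x hx => hx.1.2
  have hNle₂ : (N : Subgroup P) ≤ χ₂.ker := fun x hx => hx.2
  by_contra hcon
  push Not at hcon
  have h1 := hcon a₁ N
  have h2 := hcon a₂ N
  obtain ⟨s₁, hs₁⟩ := Subgroup.mem_zpowers_iff.mp h1
  obtain ⟨s₂, hs₂⟩ := Subgroup.mem_zpowers_iff.mp h2
  have hs₁' : (ι (IsFreeGroup.of a₁) ^ s₁)⁻¹ * z ∈ (N : Subgroup P) := by
    rw [← QuotientGroup.eq, QuotientGroup.mk_zpow]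
    exact hs₁
  have hs₂' : (ι (IsFreeGroup.of a₂) ^ s₂)⁻¹ * z ∈ (N : Subgroup P) := by
    rw [← QuotientGroup.eq, QuotientGroup.mk_zpow]
    exact hs₂
  -- apply `χ₂` to `z ≡ ι(a₁)^{s₁}`: `χ₂ z = 1`
  have e1 : χ₂ z = 1 := by
    have h := hNle₂ hs₁'
    rw [MonoidHom.mem_ker, map_mul, map_inv, map_zpow, hχ₂, hχ₀, if_neg h12, one_zpow, inv_one,
      one_mul] at h
    exact h
  -- apply `χ₂` to `z ≡ ι(a₂)^{s₂}`: `χ₂ z = s₂ mod n`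
  have e2 : χ₂ z = ofAdd ((s₂ : ℤ) : ZMod n) := by
    have h := hNle₂ hs₂'
    rw [MonoidHom.mem_ker, map_mul, map_inv, map_zpow, hχ₂, hχ₀, if_pos rfl, inv_mul_eq_one] at h
    rw [← h, ← ofAdd_zsmul, zsmul_one]
  have hdvd : (n : ℤ) ∣ s₂ := by
    rw [e1, eq_comm, ofAdd_eq_one, ZMod.intCast_zmod_eq_zero_iff_dvd] at e2
    exact e2
  -- hence `ι(a₂)^{s₂} ∈ N₀` and `z ∈ N₀`
  obtain ⟨c, hc⟩ := hdvd
  have hτn : ι (IsFreeGroup.of a₂) ^ (n : ℤ) ∈ (N₀ : Subgroup P) := by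
    rw [zpow_natCast, hndef]
    exact Subgroup.pow_index_mem _ _
  have hτs : ι (IsFreeGroup.of a₂) ^ s₂ ∈ (N₀ : Subgroup P) := by
    rw [hc, zpow_mul]
    exact Subgroup.zpow_mem _ hτn c
  have hN₀' : (ι (IsFreeGroup.of a₂) ^ s₂)⁻¹ * z ∈ (N₀ : Subgroup P) := hNle₀ hs₂'
  apply hzN₀
  have := (N₀ : Subgroup P).mul_mem hτs hN₀'
  rwa [mul_inv_cancel_left] at this

/-! ### Step 2: the wreath-product obstruction at one finite level -/

/-- **Obstruction.**  Let `Γ` be free, `ι : Γ → P` a pro-`Σ` completion (`P` profinite), `a` a free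
generator, `τ = ι(a)`, `N ⊴ P` open normal, and `z ∈ P` an element COMMUTING with `τ` whose class in `P/N`
is not a power of the class of `τ`.  Then `False`.  (Twist `z` by `τ^{-c}` into the kernel of the
coordinate character `χ : P → ℤ/m`, `m = |P/N|`, `χ(τ) = 1`; a power `k₁` of the twist has prime order
`p` in `P/N`, `p ∣ m`, `p ∈ Σ`; with `Ψ = (P → P/N, χ)` the open subgroup `U = Ψ⁻¹⟨Ψτ, Ψk₁⟩` carries a
continuous `U → (ℤ/p)²`, `τ ↦ e₁`, `k₁ ↦ e₂`, which lifts to `C_p ≀ C_p` by `exists_lift_of_isOpen`; but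
commuting lifts of `e₁, e₂` do not exist.)  Port of abc-iut-L5-t17's `eq_one_of_commute_of_zHat`.
[cite: MochizukiAbsAnab2004, Lemma 1.3.1 p.15] -/
theorem false_of_not_mem_zpowers [IsFreeGroup Γ] (hι : IsProSigmaCompletion Sigma ι)
    (N : Subgroup P) [N.Normal] (hN : IsOpen (N : Set P)) (a : IsFreeGroup.Generators Γ) {z : P}
    (hz : ι (IsFreeGroup.of a) * z = z * ι (IsFreeGroup.of a))
    (hsep : (QuotientGroup.mk z : P ⧸ N) ∉ Subgroup.zpowers (QuotientGroup.mk (ι (IsFreeGroup.of a)))) :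
    False := by
  classical
  set τ : P := ι (IsFreeGroup.of a) with hτdef
  haveI : Finite (P ⧸ N) := Subgroup.quotient_finite_of_isOpen N hN
  haveI : DiscreteTopology (P ⧸ N) := QuotientGroup.discreteTopology hN
  let π : P →* P ⧸ N := QuotientGroup.mk' N
  have hπc : Continuous π := QuotientGroup.continuous_mk
  -- `m = |P/N|`
  obtain ⟨m, hmdef⟩ : ∃ m, m = Nat.card (P ⧸ N) := ⟨_, rfl⟩
  have hm : IsSigmaInteger Sigma m := by
    rw [hmdef, ← Subgroup.index_eq_card]
    exact isSigmaInteger_index hι N hN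
  haveI : NeZero m := ⟨hm.1.ne'⟩
  have hπm : ∀ x, (π x) ^ m = 1 := fun x => by rw [hmdef]; exact pow_card_eq_one'
  -- the coordinate character `χ : P → ℤ/m`, `χ τ = 1`
  let χ₀ : Γ →* Multiplicative (ZMod m) :=
    IsFreeGroup.lift fun g => if g = a then ofAdd (1 : ZMod m) else 1
  have hχ₀a : χ₀ (IsFreeGroup.of a) = ofAdd 1 := by simp [χ₀]
  have hcard : IsSigmaInteger Sigma (Nat.card (Multiplicative (ZMod m))) := by
    rw [show Nat.card (Multiplicative (ZMod m)) = m from Nat.card_zmod m]; exact hm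
  obtain ⟨χ, hχc, hχ⟩ := exists_continuous_extend_top hι hcard χ₀
  have hχτ : χ τ = ofAdd 1 := by rw [hτdef, hχ, hχ₀a]
  -- twist `z` into `Ker χ`
  set k : P := z * (τ ^ (toAdd (χ z)).val)⁻¹ with hkdef
  have hχk : χ k = 1 := by
    rw [hkdef, map_mul, map_inv, map_pow, hχτ, ← ofAdd_nsmul, nsmul_eq_mul, mul_one,
      ZMod.natCast_zmod_val, ofAdd_toAdd, mul_inv_cancel]
  have hτk : Commute τ k := by
    rw [hkdef]
    exact (show Commute τ z from hz).mul_right ((Commute.refl τ).pow_right _).inv_right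
  have hπk : π k ≠ 1 := by
    intro h
    apply hsep
    have h' : π z = π τ ^ (toAdd (χ z)).val := by
      have h'' : π z * (π τ ^ (toAdd (χ z)).val)⁻¹ = 1 := by
        rw [← map_pow, ← map_inv, ← map_mul]; exact h
      exact mul_inv_eq_one.mp h''
    change π z ∈ Subgroup.zpowers (π τ)
    rw [h']
    exact Subgroup.pow_mem _ (Subgroup.mem_zpowers _) _
  -- a prime `p` and a power `k₁` of `k` whose image has order `p`
  have ho0 : orderOf (π k) ≠ 0 := (orderOf_pos (π k)).ne'
  have ho1 : orderOf (π k) ≠ 1 := fun h => hπk (orderOf_eq_one_iff.mp h)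
  obtain ⟨p, hpdef⟩ : ∃ p, p = (orderOf (π k)).minFac := ⟨_, rfl⟩
  haveI hp : Fact p.Prime := ⟨hpdef ▸ Nat.minFac_prime ho1⟩
  have hpo : p ∣ orderOf (π k) := hpdef ▸ Nat.minFac_dvd _
  obtain ⟨k₁, hk₁def⟩ : ∃ k₁, k₁ = k ^ (orderOf (π k) / p) := ⟨_, rfl⟩
  have hk₁ord : orderOf (π k₁) = p := by
    rw [hk₁def, map_pow]
    exact orderOf_pow_orderOf_div ho0 hpo
  have hc₁ : τ * k₁ = k₁ * τ := by
    rw [hk₁def]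
    exact (hτk.pow_right _).eq
  have hk₁χ : χ k₁ = 1 := by rw [hk₁def, map_pow, hχk, one_pow]
  have hpm : p ∣ m := by rw [← hk₁ord, hmdef]; exact orderOf_dvd_natCard (π k₁)
  have hpS : p ∈ Sigma := hm.2 p hp.out hpm
  -- `Ψ = (π, χ)`
  let Ψ : P →* (P ⧸ N) × Multiplicative (ZMod m) := π.prod χ
  have hΨc : Continuous Ψ := hπc.prodMk hχc
  have hΨτ : Ψ τ = (π τ, ofAdd 1) := by
    change (π τ, χ τ) = _
    rw [hχτ]
  have hΨk : Ψ k₁ = (π k₁, 1) := by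
    change (π k₁, χ k₁) = _
    rw [hk₁χ]
  -- the abelian image `C = ⟨Ψ τ, Ψ k₁⟩` as the range of `gC : ℤ × ℤ → P/N × ℤ/m`
  have hcomm : Commute (Ψ τ) (Ψ k₁) := by
    change Ψ τ * Ψ k₁ = Ψ k₁ * Ψ τ
    rw [← map_mul, hc₁, map_mul]
  let gC : Multiplicative ℤ × Multiplicative ℤ →* (P ⧸ N) × Multiplicative (ZMod m) :=
    MonoidHom.noncommCoprod (zpowersHom _ (Ψ τ)) (zpowersHom _ (Ψ k₁))
      fun u v => (hcomm.zpow_left u.toAdd).zpow_right v.toAdd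
  have hgC : ∀ u v : Multiplicative ℤ, gC (u, v) = Ψ τ ^ u.toAdd * Ψ k₁ ^ v.toAdd := fun u v => rfl
  let C := gC.range
  let U : Subgroup P := C.comap Ψ
  have hτU : τ ∈ U := ⟨(ofAdd 1, 1), by rw [hgC]; simp⟩
  have hkU : k₁ ∈ U := ⟨(1, ofAdd 1), by rw [hgC]; simp⟩
  have hUo : IsOpen (U : Set P) := by
    change IsOpen (Ψ ⁻¹' (C : Set ((P ⧸ N) × Multiplicative (ZMod m))))
    exact (isOpen_discrete _).preimage hΨc
  -- the kernel of `gC` dies under reduction mod `p`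
  let red : Multiplicative ℤ →* Multiplicative (ZMod p) := (Int.castAddHom (ZMod p)).toMultiplicative
  have hred : ∀ u : Multiplicative ℤ, (p : ℤ) ∣ u.toAdd → red u = 1 := by
    intro u hu
    change ofAdd ((u.toAdd : ZMod p)) = 1
    rw [(ZMod.intCast_zmod_eq_zero_iff_dvd u.toAdd p).mpr hu, ofAdd_zero]
  let βt : Multiplicative ℤ × Multiplicative ℤ →* Multiplicative (ZMod p) × Multiplicative (ZMod p) :=
    red.prodMap red
  have hτ2 : (Ψ τ).2 = ofAdd 1 := by rw [hΨτ]
  have hk2 : (Ψ k₁).2 = 1 := by rw [hΨk]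
  have hker : gC.rangeRestrict.ker ≤ βt.ker := by
    rw [MonoidHom.ker_rangeRestrict]
    rintro ⟨u, v⟩ huv
    rw [MonoidHom.mem_ker, hgC] at huv
    -- second coordinate: `m ∣ u`
    have h2 := congrArg (MonoidHom.snd (P ⧸ N) (Multiplicative (ZMod m))) huv
    rw [map_mul, map_zpow, map_zpow, map_one, MonoidHom.coe_snd, hτ2, hk2, one_zpow, mul_one,
      ← ofAdd_zsmul, zsmul_one, ofAdd_eq_one, ZMod.intCast_zmod_eq_zero_iff_dvd] at h2
    -- first coordinate: `p ∣ v`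
    have h1 := congrArg (MonoidHom.fst (P ⧸ N) (Multiplicative (ZMod m))) huv
    rw [map_mul, map_zpow, map_zpow, map_one, MonoidHom.coe_fst] at h1
    change π τ ^ u.toAdd * π k₁ ^ v.toAdd = 1 at h1
    obtain ⟨c, hc⟩ := h2
    rw [hc, zpow_mul, zpow_natCast, hπm, one_zpow, one_mul, ← orderOf_dvd_iff_zpow_eq_one,
      hk₁ord] at h1
    have hu : (p : ℤ) ∣ u.toAdd := (Int.natCast_dvd_natCast.mpr hpm).trans ⟨c, hc⟩
    rw [MonoidHom.mem_ker]
    exact Prod.ext (hred u hu) (hred v h1)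
  let β : C →* Multiplicative (ZMod p) × Multiplicative (ZMod p) :=
    gC.rangeRestrict.liftOfSurjective gC.rangeRestrict_surjective ⟨βt, hker⟩
  have hβ : ∀ w, β (gC.rangeRestrict w) = βt w := fun w =>
    MonoidHom.liftOfRightInverse_comp_apply _ _ _ _ w
  -- `ψ : U → (ℤ/p)²`, `τ ↦ (1, 0)`, `k₁ ↦ (0, 1)` (written multiplicatively)
  let ΨU : U →* C := (Ψ.comp U.subtype).codRestrict C fun x => x.2
  let ψ : U →* Multiplicative (ZMod p) × Multiplicative (ZMod p) := β.comp ΨU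
  have hΨU : ∀ (x : P) (hx : x ∈ U) (w : Multiplicative ℤ × Multiplicative ℤ),
      gC w = Ψ x → ΨU ⟨x, hx⟩ = gC.rangeRestrict w := fun x hx w hw => Subtype.ext hw.symm
  have hred1 : red (ofAdd 1) = ofAdd 1 := by
    change ofAdd (((1 : ℤ) : ZMod p)) = ofAdd 1
    rw [Int.cast_one]
  have hψτ : ψ ⟨τ, hτU⟩ = (ofAdd 1, 1) := by
    change β (ΨU ⟨τ, hτU⟩) = _
    rw [hΨU τ hτU (ofAdd 1, 1) (by rw [hgC]; simp), hβ]
    change (red (ofAdd 1), red 1) = _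
    rw [map_one red, hred1]
  have hψk : ψ ⟨k₁, hkU⟩ = (1, ofAdd 1) := by
    change β (ΨU ⟨k₁, hkU⟩) = _
    rw [hΨU k₁ hkU (1, ofAdd 1) (by rw [hgC]; simp), hβ]
    change (red 1, red (ofAdd 1)) = _
    rw [map_one red, hred1]
  have hψc : Continuous ψ := by
    have h1 : Continuous ΨU := (hΨc.comp continuous_subtype_val).subtype_mk _
    have h2 : Continuous β := continuous_of_discreteTopology
    exact h2.comp h1
  -- lift to the wreath product `C_p ≀ C_p` (a `Σ`-group) and conclude
  obtain ⟨σ, hσ⟩ := exists_wreath_prod_hom p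
  obtain ⟨θ, hθ⟩ := exists_lift_of_isOpen hι U hUo (isSigmaInteger_card_wreath p hpS)
    (RegularWreathProduct.rightHom.prod σ) (wreath_pair_surjective p σ hσ) ψ hψc
  have hxy : θ ⟨τ, hτU⟩ * θ ⟨k₁, hkU⟩ = θ ⟨k₁, hkU⟩ * θ ⟨τ, hτU⟩ := by
    rw [← map_mul, ← map_mul]
    exact congrArg θ (Subtype.ext hc₁)
  have hθτ := hθ ⟨τ, hτU⟩
  have hθk := hθ ⟨k₁, hkU⟩
  rw [hψτ, MonoidHom.prod_apply, Prod.mk.injEq] at hθτ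
  rw [hψk, MonoidHom.prod_apply, Prod.mk.injEq] at hθk
  exact wreath_not_commute p (θ ⟨τ, hτU⟩) (θ ⟨k₁, hkU⟩) hθτ.1 hθk.1 ((hσ _).symm.trans hθk.2) hxy

/-! ### Center-freeness and slimness -/

/-- **The pro-`Σ` completion of a nonabelian free group is center-free.**  For `Γ` free (`IsFreeGroup`)
and nonabelian, `ι : Γ → P` a pro-`Σ` completion with `P` profinite: `Z(P) = 1`.
[cite: MochizukiAbsAnab2004, Lemma 1.3.1 p.15] -/
theorem center_eq_bot [IsFreeGroup Γ] [T2Space P] (hΓ : ∃ x y : Γ, x * y ≠ y * x)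
    (hι : IsProSigmaCompletion Sigma ι) : Subgroup.center P = ⊥ := by
  rw [eq_bot_iff]
  intro z hz
  rw [Subgroup.mem_bot]
  by_contra hz1
  obtain ⟨a₁, a₂, h12⟩ := exists_generators_ne hΓ
  obtain ⟨a, N, hsep⟩ := exists_openNormal_not_mem_zpowers hι h12 hz1
  exact false_of_not_mem_zpowers hι (N : Subgroup P) N.isOpen' a (Subgroup.mem_center_iff.mp hz _) hsep

/-- **[AbsAnab] Lemma 1.3.1, affine case, pro-`Σ`: the pro-`Σ` completion of a nonabelian free group is
SLIM** — for `Γ` free (`IsFreeGroup`, any rank) and nonabelian and `ι : Γ → P` a pro-`Σ` completion in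
the sense of `IsProSigmaCompletion` with `P` profinite, the centralizer of every open subgroup of `P` is
trivial.  (Remark 0.1.3: for `H` open and `z ∈ Z_P(H)`, `z` is central in the open subgroup
`W = ⟨H, z⟩`, and `ι⁻¹(W) → W` is a pro-`Σ` completion of a nonabelian free group, center-free by
`center_eq_bot`.) [cite: MochizukiAbsAnab2004, Lemma 1.3.1 p.15] -/
theorem isSlimGroup [IsFreeGroup Γ] [T2Space P] (hΓ : ∃ x y : Γ, x * y ≠ y * x)
    (hι : IsProSigmaCompletion Sigma ι) : IsSlimGroup P := by
  refine ⟨fun H hH => ?_⟩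
  rw [eq_bot_iff]
  intro z hz
  rw [Subgroup.mem_bot]
  -- `W = ⟨H, z⟩` is open and `z` is central in `W`
  let W : Subgroup P := H ⊔ Subgroup.zpowers z
  have hWo : IsOpen (W : Set P) := Subgroup.isOpen_mono le_sup_left hH
  have hzW : z ∈ W := Subgroup.mem_sup_right (Subgroup.mem_zpowers z)
  have hle : W ≤ Subgroup.centralizer {z} :=
    sup_le (fun h hh => Subgroup.mem_centralizer_singleton_iff.mpr (Subgroup.mem_centralizer_iff.mp hz h hh))
      ((Subgroup.zpowers_le).mpr (Subgroup.mem_centralizer_singleton_iff.mpr rfl))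
  have hzc : ∀ w ∈ W, w * z = z * w := fun w hw => Subgroup.mem_centralizer_singleton_iff.mp (hle hw)
  -- `ι⁻¹(W) → W` is a pro-`Σ` completion of a nonabelian free group
  have hιW := restrict_isOpen hι W hWo
  haveI : CompactSpace W := isCompact_iff_compactSpace.mp (W.isClosed_of_isOpen hWo).isCompact
  haveI : (W.comap ι).FiniteIndex := finiteIndex_comap hι W hWo
  obtain ⟨x, y, hxy⟩ := hΓ
  obtain ⟨x', hx', y', hy', hxy'⟩ := exists_not_commute_of_finiteIndex_of_isFreeGroup hxy (W.comap ι)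
  have hΓW : ∃ u v : W.comap ι, u * v ≠ v * u :=
    ⟨⟨x', hx'⟩, ⟨y', hy'⟩, fun h => hxy' (congrArg Subtype.val h)⟩
  have hcen : (⟨z, hzW⟩ : W) ∈ Subgroup.center W :=
    Subgroup.mem_center_iff.mpr fun w => Subtype.ext (hzc w w.2)
  rw [center_eq_bot hΓW hιW, Subgroup.mem_bot] at hcen
  exact congrArg Subtype.val hcen

end Profinite

end Literature.AnabelianGeometry.SemiGraphs.SemiGraphOfAnabelioids.IsProSigmaCompletion
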